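import Mathlib.NumberTheory.NumberField.InfinitePlace.TotallyRealComplex
import Literature.NumberTheory.Automorphic.StrongArtinGL2
import Literature.NumberTheory.Automorphic.LanglandsTunnellCases
import Literature.NumberTheory.Automorphic.OddArtinWeightOneProofs
import Literature.NumberTheory.GaloisRepresentations.ProjectiveTypeProofs
import HarnessLib

/-!
# The odd two-dimensional Artin conjecture over totally real fields (Pilloni–Stroh)

Topic `NumberTheory/Automorphic`. ONE named fact (D-0014, `def … : Prop`, statement only) — the
icosahedral case of the strong Artin conjecture for TOTALLY ODD two-dimensional representations
of a TOTALLY REAL number field, which is the new theorem of Pilloni–Stroh (Astérisque 382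
(2016), Théorème 0.3, proved in the icosahedral case via Cor. 2.2.1; the solvable cases being
Hecke–Langlands–Tunnell) — and the PROVED assembly of the full Théorème 0.3 from it and the
tree's three solvable cases (`Automorphic/StrongArtinGL2`), by Klein's classification (a theorem
of the tree, `klein_finite_subgroup_pgl_two_holds`), exactly as `strongArtin_of_isSolvable_of_cases`
and `strongArtin_of_isOdd_of_cases` (base field `ℚ`, `Automorphic/OddArtinWeightOneProofs`) are
assembled. The module docstring of `Automorphic/OddArtinWeightOne` names the gap filled here:
"Base field `ℚ` only. Over totally real `F` the odd case is also a theorem (Pilloni–Stroh,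
Kassaei–Sasaki–Tian, Sasaki; Calegari 2023 §4) but is not vendored here."

## Source (read 2026-08-22 from the authors' final preprint, 77 pp., numbering identical to the
Astérisque version and to the citations `[PS16b, Thm. 0.3]`, `[PS16b, Prop. 2.1.3]` of
Boxer–Calegari–Gee–Pilloni, Publ. IHÉS 134 (2021), p. 474)

* V. Pilloni, B. Stroh, *Surconvergence, ramification et modularité*, Astérisque 382 (2016)
  195–266 (`PilloniStroh2016Asterisque`). p. 1, standing: "Soit `p` un nombre premier et `F` un
  corps totalement réel … Totalement impair signifie que `det ρ(c_τ) = −1` pour toute conjugaison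
  complexe `c_τ ∈ G_F` associée à tout plongement `τ : F → ℝ`."  **Théorème 0.3** (p. 2), verbatim:
  "Soit `F` un corps totalement réel et `ρ : G_F → GL₂(ℂ)` une représentation totalement impaire
  irréductible d'image finie. La représentation `ρ` est modulaire attachée à une forme propre et
  cuspidale de poids un. En particulier, la fonction `L(ρ, s)` admet un prolongement holomorphe à
  tout le plan complexe."  p. 2: "Le théorème 0.3 a été prouvé par Hecke, Langlands et Tunnell
  dans le cas d'image résoluble. Nous traitons ici le cas icosahédral".  Corollaire 2.2.2 (p. 10)
  `=` Théorème 0.3, proof verbatim: "D'après la classification des sous-groupes finis de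
  `PGL₂(ℂ)`, on sait que `Proj(ρ)(G_F)` est isomorphe à `A₄`, `S₄`, `A₅` ou au groupe dihédral
  `D_{2r}` … Dans les cas `D_{2r}`, `A₄` et `S₄`, la modularité de `ρ` résulte des travaux
  classiques de Artin, Hecke, Langlands [La] et Tunnell [Tu1]. Il reste à traiter le cas `A₅`. …
  On applique alors le corollaire 2.2.1." (Cor. 2.2.1, p. 10: a geometric totally odd
  `ρ : G_F → GL₂(ℤ̄₅)` of Hodge–Tate weights `0` with `Proj(ρ̄)(G_F) ≅ PSL₂(𝔽₅) ≅ A₅` is modular;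
  from Prop. 2.1.3 and the modularity lifting theorem Thm. 0.4.)
* Secondary: F. Calegari, *Reciprocity in the Langlands program since Fermat's Last Theorem*,
  ICM 2022, §4 p. 618 ("the `n = 2` Artin conjecture for totally real fields is now completely
  resolved under the additional assumption that the representation is odd").
* Use in the tree's neighbourhood: it is the input `[PS16b, Thm. 0.3]` of the proof of
  Boxer–Calegari–Gee–Pilloni 2021, Prop. 10.1.3 (1) (residual modularity of `ρ̄₃ : G_E → GL₂(𝔽₉)`
  with projective image `A₅` over a real quadratic `E`), `BoxerEtAl2021`, p. 474.

## Rendering (same conventions as `Automorphic/StrongArtinGL2`, whose module docstring applies)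

* "`F` totalement réel": Mathlib's `NumberField.IsTotallyReal F` (every infinite place real).
* "totalement impaire": the tree's `FramedGaloisRep.IsOdd` (`GaloisRepresentations/GaloisRep`),
  which for a general number field `F` is by definition `det σ(c) = −1` for every complex
  conjugation `c` attached to every real embedding `φ : F →+* ℝ` (`IsComplexConjugation φ c`) —
  i.e. exactly "totally odd"; over `ℚ` it is the usual oddness.
* "irréductible": `σ.toGaloisRep.IsIrreducible`; "d'image finie" is automatic for a continuous
  `σ : Γ_F → GL₂(ℂ)` (`finite_range_toMonoidHom`, a theorem of the tree) and is not a hypothesis.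
* "modulaire attachée à une forme propre et cuspidale de poids un" is rendered, as for the three
  solvable cases `strongArtin_of_is{Dihedral,Tetrahedral,Octahedral}Type`, by the existence of a
  cuspidal automorphic representation `π` of `GL₂(𝔸_F)` with `π = π(σ)` in Tunnell's
  almost-everywhere sense (`IsPiOfArtinRep σ π.1`: Frobenius–Satake compatibility at all but
  finitely many finite places). The tree has Hilbert cusp forms of weight one only over `ℚ`
  (`CuspForm (Gamma1 N) 1`), and the pin cannot express `π_∞` ("Design notes" of
  `StrongArtinGL2`); the automorphic representation generated by the weight-one Hilbert newform of
  the source is such a `π` (its local factors agree with those of `σ` at all unramified places),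
  so the `Prop` below is implied by, and over `ℚ` equivalent to (Gelbart's Prop. 4.2, the tree's
  `exists_isNewform1_of_isPiOfArtinRep`), the printed conclusion — never stronger than it.
* The "En particulier" clause (entire continuation of `L(s, ρ)`) is NOT a second fact: it is
  PROVED below from the assembly and the tree's bridge
  `hasEntireContinuation_artinLFunction_of_isPiOfArtinRep` (Tunnell 1981, p. 173 ¶2; named fact
  of `Automorphic/LanglandsTunnellCases`), threaded as a hypothesis.
* D-0026: the file introduces exactly one `def … : Prop` (the icosahedral case, the part of
  Théorème 0.3 that is not Langlands–Tunnell); Théorème 0.3 for all projective types is the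
  THEOREM `pilloniStroh_strongArtin_of_isOdd_of_cases` taking the four cases as hypotheses, so
  that a discharge of the four leaves discharges it. The EVEN case over totally real fields
  (some `det σ(c_τ) = +1`) is open and is asserted nowhere in this file.
* Mathlib has no Artin representations / automorphic representations; nothing here duplicates
  a Mathlib declaration (`NumberField.IsTotallyReal`, `IsSolvable`, `Finite` are Mathlib's).
-/

noncomputable section

open scoped MatrixGroups NumberField
open NumberField IsDedekindDomain Field

namespace Literature.NumberTheory.Automorphic

open GaloisRepresentations

/-! ### The named fact: the odd icosahedral case over a totally real field -/

/-- **Pilloni–Stroh: strong Artin for totally odd icosahedral representations of a totally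
real field** (Astérisque 382 (2016), Théorème 0.3 in the icosahedral case `=` the case "Il reste
à traiter le cas `A₅`" of the proof of Corollaire 2.2.2, settled by Corollaire 2.2.1; Thm. 0.3
verbatim: "Soit `F` un corps totalement réel et `ρ : G_F → GL₂(ℂ)` une représentation totalement
impaire irréductible d'image finie. La représentation `ρ` est modulaire attachée à une forme
propre et cuspidale de poids un."). For a totally real number field `F`
(`NumberField.IsTotallyReal`) and a continuous `σ : Γ_F → GL₂(ℂ)` which is irreducible, totally
odd (`FramedGaloisRep.IsOdd`: `det σ(c) = −1` at every complex conjugation of every real place)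
and of icosahedral type (projective image `≅ A₅`, `IsIcosahedralType`), `π(σ)` exists: there is
a cuspidal automorphic representation `π` of `GL₂(𝔸_F)` with `π = π(σ)` (`IsPiOfArtinRep`; the
compactness fact `hcpt` typing `π` is part of the existential, as in `strongArtin_of_isOctahedralType`).
The irreducibility hypothesis is implied by the icosahedral type and is kept for the assembly.
Over `F = ℚ` this is the odd icosahedral case of Khare–Wintenberger 2009, Thm. 10.1 (ii) /
Buzzard–Dickinson–Shepherd-Barron–Taylor 2001, Thm. A (the hypothesis `hI` of
`strongArtin_of_isOdd_of_cases`; see `strongArtin_of_isOdd_rat_of_pilloniStroh`). Named fact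
(D-0014). [cite: PilloniStroh2016Asterisque, Thm. 0.3 and Cor. 2.2.1–2.2.2 (pp. 2, 10)] -/
def pilloniStroh_strongArtin_of_isIcosahedralType : Prop :=
  ∀ {F : Type} [Field F] [NumberField F] [IsTotallyReal F]
    (σ : GaloisRepresentations.FramedArtinRep F 2),
    σ.toGaloisRep.IsIrreducible → σ.IsOdd →
      GaloisRepresentations.IsIcosahedralType σ.toMonoidHom →
      ∃ (hcpt : isCompact_glFiniteIntegralLevel 2 F) (π : CuspidalAutomorphicRepData 2 F hcpt),
        IsPiOfArtinRep σ π.1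

/-! ### Théorème 0.3 assembled from its four cases (proved) -/

/-- **Pilloni–Stroh, Théorème 0.3 (automorphic form), from its cases** (Astérisque 382 (2016),
proof of Corollaire 2.2.2, p. 10: "`Proj(ρ)(G_F)` est isomorphe à `A₄`, `S₄`, `A₅` ou au groupe
dihédral `D_{2r}` … Dans les cas `D_{2r}`, `A₄` et `S₄`, la modularité de `ρ` résulte des travaux
classiques de Artin, Hecke, Langlands et Tunnell. Il reste à traiter le cas `A₅`"). Grant the
dihedral (Jacquet–Langlands 1970, §12), tetrahedral (Langlands 1980, §3) and octahedral (Tunnell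
1981) cases of the strong Artin conjecture over number fields (the named facts of
`Automorphic/StrongArtinGL2`) and the odd icosahedral case over totally real fields
(`pilloniStroh_strongArtin_of_isIcosahedralType`). Then for every totally real number field `F`,
every continuous irreducible totally odd `σ : Γ_F → GL₂(ℂ)` has a cuspidal `π` on `GL₂(𝔸_F)`
with `π = π(σ)`: `σ` has finite image (`finite_range_toMonoidHom`), so by Klein's classification
— the tree's theorem `klein_finite_subgroup_pgl_two_holds`, through
`projectiveType_of_isIrreducible`, the cyclic type being excluded by irreducibility — it is of
dihedral, tetrahedral, octahedral or icosahedral type, and the corresponding case applies.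
[cite: PilloniStroh2016Asterisque, Thm. 0.3 and proof of Cor. 2.2.2 (p. 10)]
[cite: Gelbart1997, Lecture I, Remark 1.3 (1)] -/
theorem pilloniStroh_strongArtin_of_isOdd_of_cases (hd : strongArtin_of_isDihedralType)
    (ht : strongArtin_of_isTetrahedralType) (ho : strongArtin_of_isOctahedralType)
    (hI : pilloniStroh_strongArtin_of_isIcosahedralType)
    {F : Type} [Field F] [NumberField F] [IsTotallyReal F]
    (σ : GaloisRepresentations.FramedArtinRep F 2) (hirr : σ.toGaloisRep.IsIrreducible)
    (hodd : σ.IsOdd) :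
    ∃ (hcpt : isCompact_glFiniteIntegralLevel 2 F) (π : CuspidalAutomorphicRepData 2 F hcpt),
      IsPiOfArtinRep σ π.1 := by
  haveI : Finite σ.toMonoidHom.range := finite_range_toMonoidHom σ
  have hirr' : (GaloisRepresentations.toStdRepresentation σ.toMonoidHom).IsIrreducible :=
    (isIrreducible_toStdRepresentation_iff σ).mpr hirr
  rcases GaloisRepresentations.projectiveType_of_isIrreducible
      GaloisRepresentations.klein_finite_subgroup_pgl_two_holds σ.toMonoidHom hirr' with
    h | h | h | h
  · exact hd σ hirr h
  · exact ht σ hirr h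
  · exact ho σ hirr h
  · exact hI σ hirr hodd h

/-- **Théorème 0.3, "En particulier" clause: Artin's conjecture for totally odd two-dimensional
representations of a totally real field** (Astérisque 382 (2016), Thm. 0.3: "En particulier, la
fonction `L(ρ, s)` admet un prolongement holomorphe à tout le plan complexe"). PROVED from the
assembly `pilloniStroh_strongArtin_of_isOdd_of_cases` and the bridge "`π = π(σ)` with `π` cuspidal
`⇒ L(s, σ)` entire" (Tunnell 1981, p. 173 ¶2; the named fact
`hasEntireContinuation_artinLFunction_of_isPiOfArtinRep` of `Automorphic/LanglandsTunnellCases`),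
all threaded as hypotheses; so the clause adds no debt of its own.
[cite: PilloniStroh2016Asterisque, Thm. 0.3 (p. 2)] [cite: Tunnell1981, p. 173] -/
theorem pilloniStroh_artinConjecture_of_isOdd_of_cases (hd : strongArtin_of_isDihedralType)
    (ht : strongArtin_of_isTetrahedralType) (ho : strongArtin_of_isOctahedralType)
    (hI : pilloniStroh_strongArtin_of_isIcosahedralType)
    (hB : hasEntireContinuation_artinLFunction_of_isPiOfArtinRep)
    {F : Type} [Field F] [NumberField F] [IsTotallyReal F]
    (σ : GaloisRepresentations.FramedArtinRep F 2) (hirr : σ.toGaloisRep.IsIrreducible)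
    (hodd : σ.IsOdd) :
    GaloisRepresentations.LFunction.HasEntireContinuation
      (GaloisRepresentations.artinLFunction σ.toArtinRep) := by
  obtain ⟨hcpt, π, hπ⟩ := pilloniStroh_strongArtin_of_isOdd_of_cases hd ht ho hI σ hirr hodd
  exact hB σ hcpt π hirr hπ

/-! ### Consistency with the base field `ℚ` (proved) -/

/-- **Over `ℚ` the Pilloni–Stroh fact is the odd icosahedral hypothesis `hI` of
`strongArtin_of_isOdd_of_cases`** (`ℚ` is totally real: Mathlib's instance
`NumberField.IsTotallyReal ℚ`; Khare–Wintenberger 2009, remark after Thm. 10.1, p. 18, and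
Pilloni–Stroh p. 2: "lorsque `F = ℚ`, Khare [Kh] a prouvé que le théorème 0.3 était une
conséquence de la conjecture de modularité de Serre établie dans [KW]"). [folklore]
[cite: PilloniStroh2016Asterisque, p. 2] -/
theorem strongArtin_of_isOdd_rat_of_pilloniStroh (hI : pilloniStroh_strongArtin_of_isIcosahedralType)
    (σ : GaloisRepresentations.FramedArtinRep ℚ 2) (hirr : σ.toGaloisRep.IsIrreducible)
    (hodd : σ.IsOdd) (hico : GaloisRepresentations.IsIcosahedralType σ.toMonoidHom) :
    ∃ (hcpt : isCompact_glFiniteIntegralLevel 2 ℚ) (π : CuspidalAutomorphicRepData 2 ℚ hcpt),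
      IsPiOfArtinRep σ π.1 :=
  hI σ hirr hodd hico

/-- **Khare–Wintenberger's weight-one fact from Pilloni–Stroh's icosahedral case** (over `ℚ`):
the named fact `khareWintenberger_weightOne_of_isOdd` (`Automorphic/OddArtinWeightOne`) follows
from the three solvable cases, the Pilloni–Stroh fact specialised to `F = ℚ`, Gelbart's Prop. 4.1
(`frobSatakeCompatibleAt_of_isPiOfArtinRep`) and the weight-one dictionary Prop. 4.2
(`exists_isNewform1_of_isPiOfArtinRep`) — by `khareWintenberger_weightOne_of_isOdd_of_icosahedral`.
So the present fact, restricted to `ℚ`, is exactly the missing leaf `hI` of that assembly.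
[cite: KhareWintenberger2009, Thm. 10.1 (ii) and remark p. 18]
[cite: PilloniStroh2016Asterisque, Thm. 0.3] -/
theorem khareWintenberger_weightOne_of_isOdd_of_pilloniStroh (hd : strongArtin_of_isDihedralType)
    (ht : strongArtin_of_isTetrahedralType) (ho : strongArtin_of_isOctahedralType)
    (hI : pilloniStroh_strongArtin_of_isIcosahedralType)
    (hAE : frobSatakeCompatibleAt_of_isPiOfArtinRep)
    (hW1 : exists_isNewform1_of_isPiOfArtinRep) :
    khareWintenberger_weightOne_of_isOdd :=
  khareWintenberger_weightOne_of_isOdd_of_icosahedral hd ht ho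
    (fun σ hirr hodd hico => hI σ hirr hodd hico) hAE hW1

/-- **Solvable OR totally odd suffices** (the union of Langlands–Tunnell and Pilloni–Stroh, as
used by Boxer–Calegari–Gee–Pilloni 2021, proof of Prop. 10.1.3, p. 474: solvable image by "the
theorems of Langlands and Tunnell", projective image `A₅` by "the odd Artin conjecture for
totally real fields ([PS16b, Thm. 0.3])"): over a totally real `F`, an irreducible
`σ : Γ_F → GL₂(ℂ)` which is EITHER of solvable image OR totally odd has a cuspidal `π(σ)`.
Proved from the cases (`strongArtin_of_isSolvable_of_cases` for the first disjunct).
[cite: BoxerEtAl2021, proof of Prop. 10.1.3 (p. 474)] [cite: PilloniStroh2016Asterisque, Thm. 0.3] -/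
theorem strongArtin_of_isSolvable_or_isOdd_of_cases (hd : strongArtin_of_isDihedralType)
    (ht : strongArtin_of_isTetrahedralType) (ho : strongArtin_of_isOctahedralType)
    (hI : pilloniStroh_strongArtin_of_isIcosahedralType)
    {F : Type} [Field F] [NumberField F] [IsTotallyReal F]
    (σ : GaloisRepresentations.FramedArtinRep F 2) (hirr : σ.toGaloisRep.IsIrreducible)
    (h : IsSolvable (GaloisRepresentations.projectiveImage σ.toMonoidHom) ∨ σ.IsOdd) :
    ∃ (hcpt : isCompact_glFiniteIntegralLevel 2 F) (π : CuspidalAutomorphicRepData 2 F hcpt),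
      IsPiOfArtinRep σ π.1 := by
  rcases h with hsolv | hodd
  · exact strongArtin_of_isSolvable_of_cases GaloisRepresentations.klein_finite_subgroup_pgl_two_holds
      hd ht ho σ hirr hsolv
  · exact pilloniStroh_strongArtin_of_isOdd_of_cases hd ht ho hI σ hirr hodd

end Literature.NumberTheory.Automorphic

end
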